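import Summits.ABC.ABC.Theses.IsogenyGlueCongruence
import Literature.NumberTheory.EllipticCurves.DegreeConjectureAbcSemistable
import Literature.NumberTheory.EllipticCurves.SilvermanHeightCovolumeProofs
import Literature.NumberTheory.EllipticCurves.ModularCurveManinConstantProofs
import HarnessLib

/-!
# Route IsogenyGlueCongruence — support item `FrameOverPetersson` (stmt-ABC-10885)

The frame `X → abc` of route `ABC/IsogenyGlueCongruence`, relative to the Petersson lower bound:

> `(Petersson lower bound) → SemistableDegreeConjecture → Literature.Abc.ABCConjecture`.

Here the first hypothesis is verbatim the named fact
`Literature.NumberTheory.EllipticCurves.ModularForms.murty_petersson_newform_lower_bound`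
(`‖f_E‖² ≫_ε N^{1−ε}`, Hoffstein–Lockhart 1994 / Murty 1999; route item `PeterssonLowerBound`,
stmt-ABC-10870, inlined), `SemistableDegreeConjecture` is the sharp modular-degree conjecture for
semistable elliptic curves over `ℚ` in global minimal form (`∃ D, deg φ ≤ C(ε) N^{2+ε}` at level
`N = N_E`), and `Literature.Abc.ABCConjecture` is the summit statement (`ABC` unfolds to it).

The mathematics ("sharp semistable modular-degree conjecture ⟹ abc": Frey 1989; M. R. Murty 1999,
Thm. 1 (i); Pasten 2024, §3 and Rem. 3.3) is entirely in the tree: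
`Literature.NumberTheory.EllipticCurves.abcLe_of_semistableDegreeBound` takes the Petersson bound,
Silverman's covolume inequality (PROVED, `silverman1986_discriminant_c4_covolume_holds`) and a
degree bound of the shape `deg ≤ C · c² · N^{2+ε}` (`c` the Manin constant of the datum) to the
`≤`-form of abc, and `abcLt_of_abcLe` converts to the strict / positive-constant form, which is
literally the body of `Literature.Abc.ABCConjecture`. The only work here is the padding
`deg ≤ C N^{2+ε} ⟹ deg ≤ max(C,0) · c² · N^{2+ε}`, valid because the Manin constant is a non-zero
integer (`maninConstant_ne_zero_holds`, Edixhoven 1991 §1), so `c² ≥ 1`.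

This theorem is unconditional: its only unproved analytic input, the Petersson bound, is a
hypothesis of the registered signature. With `hP := murty_petersson_newform_lower_bound_holds`
(the day that fact is discharged) the same term closes the route's `Assembly` (stmt-ABC-2049).

## References

* G. Frey, *Links between solutions of A − B = C and elliptic curves*, LNM 1380 (1989). [Frey1989]
* M. R. Murty, *Bounds for congruence primes*, Proc. Sympos. Pure Math. 66.1 (1999), Thm. 1.
  [MurtyCongruencePrimes1999]
* H. Pasten, *Shimura curves and the abc conjecture*, J. Number Theory 254 (2024) =
  arXiv:1705.09251, §3 Rem. 3.3. [PastenShimura2024]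
* J. H. Silverman, *Heights and elliptic curves*, in: Arithmetic Geometry (1986), Cor. 2.3.
  [Silverman1986]
-/

-- `Summit.<Summit>.<Problem>` is the mandated summit-side namespace (CONVENTIONS §2); for the
-- single-conjunct summit `ABC` the two coincide, so the duplicate `ABC.ABC` is deliberate.
set_option linter.dupNamespace false

namespace Summit.ABC.ABC.Theorems

open Literature.NumberTheory.EllipticCurves Literature.NumberTheory.EllipticCurves.ModularForms

/-- **Manin-constant padding.** The sharp semistable modular-degree conjecture
`SemistableDegreeConjecture` (`∃ D, deg φ ≤ C(ε) · N^{2+ε}` for every semistable `W/ℚ` in global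
minimal form, `N = N_E`) implies the `c²`-weighted form consumed by
`abcLe_of_semistableDegreeBound`: `∃ D, deg φ ≤ max(C(ε),0) · c² · N^{2+ε}`, where `c ∈ ℤ ∖ {0}`
is the Manin constant of the datum (`maninConstant_ne_zero_holds`, so `1 ≤ c²`). [folklore] -/
theorem semistableDegreeBound_cSq_of_semistableDegreeConjecture
    (hX : Summit.ABC.ABC.Theses.IsogenyGlueCongruence.SemistableDegreeConjecture) :
    ∀ ε : ℝ, 0 < ε → ∃ C : ℝ, ∀ (W : WeierstrassCurve ℚ) [W.IsElliptic]
      [W.IsGloballyMinimal] [NeZero (W.conductorNorm ℤ)], W.IsSemistable ℤ →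
        ∃ D : ModularParametrizationData W (W.conductorNorm ℤ),
          (D.deg : ℝ) ≤ C * (D.c : ℝ) ^ 2 * ((W.conductorNorm ℤ : ℕ) : ℝ) ^ (2 + ε) := by
  intro ε hε
  obtain ⟨C, hC⟩ := hX ε hε
  refine ⟨max C 0, fun W _ _ _ hss ↦ ?_⟩
  obtain ⟨D, hD⟩ := hC W hss
  have hD' : (D.deg : ℝ) ≤ C * ((W.conductorNorm ℤ : ℕ) : ℝ) ^ (2 + ε) := hD
  refine ⟨D, hD'.trans ?_⟩
  have hc : (1 : ℝ) ≤ (D.c : ℝ) ^ 2 := by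
    have h1 : (1 : ℤ) ≤ D.c ^ 2 := by
      have h0 : D.c ≠ 0 := D.maninConstant_ne_zero_holds
      nlinarith [Int.one_le_abs h0, sq_abs D.c]
    exact_mod_cast h1
  have hN0 : (0 : ℝ) ≤ ((W.conductorNorm ℤ : ℕ) : ℝ) ^ (2 + ε) := by positivity
  calc C * ((W.conductorNorm ℤ : ℕ) : ℝ) ^ (2 + ε)
      ≤ max C 0 * ((W.conductorNorm ℤ : ℕ) : ℝ) ^ (2 + ε) :=
        mul_le_mul_of_nonneg_right (le_max_left _ _) hN0
    _ = max C 0 * 1 * ((W.conductorNorm ℤ : ℕ) : ℝ) ^ (2 + ε) := by ring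
    _ ≤ max C 0 * (D.c : ℝ) ^ 2 * ((W.conductorNorm ℤ : ℕ) : ℝ) ^ (2 + ε) :=
        mul_le_mul_of_nonneg_right (mul_le_mul_of_nonneg_left hc (le_max_right C 0)) hN0

/-- **Item stmt-ABC-10885 (`FrameOverPetersson`), proved.** The Petersson lower bound
`‖f_E‖² ≫_ε N^{1−ε}` for newforms of elliptic curves and the sharp modular-degree conjecture for
semistable elliptic curves over `ℚ` (`SemistableDegreeConjecture`) together imply the abc
conjecture (`Literature.Abc.ABCConjecture`, definitionally the summit statement `ABC`). Proof: the
tree theorem `abcLe_of_semistableDegreeBound` (Zagier's identity `4π²c²(f,f) = deg · covol Λ`,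
Silverman's covolume inequality — discharged by `silverman1986_discriminant_c4_covolume_holds` —
and the semistable global minimal equation of the Serre-normalised Frey–Hellegouarch curve with
`N ∣ rad(abc)`), fed with the `c²`-padded degree bound
(`semistableDegreeBound_cSq_of_semistableDegreeConjecture`), then `abcLt_of_abcLe`; the Petersson
hypothesis is definitionally `murty_petersson_newform_lower_bound`.
[cite: MurtyCongruencePrimes1999, Thm. 1 (i)] -/
theorem frameOverPetersson_proof :
    Summit.ABC.ABC.Theses.IsogenyGlueCongruence.FrameOverPetersson := by
  unfold Summit.ABC.ABC.Theses.IsogenyGlueCongruence.FrameOverPetersson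
  intro hP hX
  exact abcLt_of_abcLe (abcLe_of_semistableDegreeBound hP
    silverman1986_discriminant_c4_covolume_holds
    (semistableDegreeBound_cSq_of_semistableDegreeConjecture hX))

end Summit.ABC.ABC.Theorems
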